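import Summits.QuantumFields.YangMills.Theorems.VirialFluxGapQuaternionRadialFlow
import Summits.QuantumFields.YangMills.Theorems.VirialFluxGapRingFrameHessian
import Summits.QuantumFields.YangMills.Theorems.VirialFluxGapConstantHistoryDeficit
import HarnessLib

/-!
# Route `VirialFluxGap` (YangMills): the RADIAL FLOW OF A CONSTANT HISTORY — the zero-mode field reproduces the commutator quartic on the
# constant-history cone, EXACTLY

Brick (C1-ii) of the central charts for ⟨stmt-QuantumFields-24141⟩ (LEAD design notes №1∕№2∕№4).  A constant ring history (every slice the constant
configuration `u : Fin 3 → SU(2)`, constant seam `q`) moved by a BLOCKWISE-CONSTANT multi-direction curve (✓`FrameHessian.multiCurve` with the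
direction `quatMatrix (p k)` on every slice link of direction `k` and `quatMatrix p₄` on every seam site) stays constant (`const_mul_multiCurve`), so
its deficit along the curve is the commutator quartic of the moving quaternions (✓`ConstantHistory.ringDeficit_const_eq_commutator_quartic`).
With RADIAL generators `p_k = c_k·Im A_k`, `p₄ = c₄·Im B` (`A_k = su2Quat u_k`, `B = su2Quat q`) the derivative at `s = 0` is EXPLICIT
(✓`hasDerivAt_su2Quat_mul_expSU`, ✓`hasDerivAt_normSq_comm_radial`):

  ★★★ `hasDerivAt_ringDeficit_const_radial` :
  `d/ds|₀ F₀(const·γ(s)) = 2L⁴·Σ_{k<k′} 2(c_k Re A_k + c_{k′} Re A_{k′})·‖[A_k,A_{k′}]‖² + L³·Σ_k 2(c_k Re A_k + c₄ Re B)·‖[A_k,B]‖²`,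

and ★★ `frameD_ringPoly_const_radial` identifies this number with `frameD Y ringPoly (ringCoord const)` (✓`FrameHessian.hasDerivAt_ringDeficit_multiCurve`,
uniqueness of derivatives).  With `c = ½σ` (the zero-mode block field ✓`CentralZeroModeField` restricted to the cone, where block averages are the
common values) every quartic term is reproduced with the factor `(σ_k Re A_k + σ_{k′} Re A_{k′})/2·2 = σRe + σ′Re′` — i.e. `X_z·F₀ = 2F₀` at the
central toron and `X_z·F₀ ≥ 2(1 − max_B(1 − σ_B Re q_B))·F₀` on the cone: the (E1) weight count of the `12` zero modes, exact and β-free.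

HONEST FRAMING: the constant-history CONE only (12 of the `18L⁴ + 3L³` dimensions); the transverse part, the chart inequalities and the patching are
NOT here; ⟨24141⟩ stays OPEN; the Yang–Mills mass gap is NOT proved; no summit is proved by a line.  THEOREMS ONLY (0 `def`, 0 `sorry`),
standard axioms.  Width seat `ym-line-sfw-p2-w3` g58 (cell ym-idea-1, free hands), `--supports stmt-QuantumFields-24141`.
References: [cite: CosteEtAl1985]; [cite: Luscher1983, §2]; [cite: arXiv220412737, §2 (2.4) (p. 10)].
-/

set_option autoImplicit false

noncomputable section

open scoped Matrix ContDiff Topology Quaternion BigOperators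
open Literature.MathematicalPhysics.QuantumFieldTheory hiding SU2
open Literature.MathematicalPhysics.QuantumLattice
open Literature.MathematicalPhysics.QuantumFieldTheory.SUNBakryEmery (expSU coe_expSU matTop)

namespace Summit.QuantumFields.YangMills.Theorems.VirialFluxGap.FrameDerivative

open Summit.QuantumFields.YangMills.Theorems.FemtoTransferGap
open Summit.QuantumFields.YangMills.Theorems.VirialFluxGap.RingDeficit
open Summit.QuantumFields.YangMills.Theorems.VirialFluxGap.FrameHessian
open Summit.QuantumFields.YangMills.Theorems.VirialFluxGap.ConstantHistory

variable {L : ℕ} [NeZero L]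

open scoped Matrix.Norms.Frobenius

attribute [local instance 2000] Literature.MathematicalPhysics.QuantumFieldTheory.SUNBakryEmery.matTop

/-! ## §1 A constant history moved blockwise stays constant -/

omit [NeZero L] in
/-- ★ **A constant history moved by a blockwise-constant multi-direction curve is the constant history of the moved variables.** [folklore] -/
theorem const_mul_multiCurve (u : Fin 3 → SU2) (q : SU2) (p : Fin 3 → ℍ) (p₄ : ℍ)
    (hp : ∀ k, (quatMatrix (p k))ᴴ = -quatMatrix (p k)) (hp0 : ∀ k, (quatMatrix (p k)).trace = 0)
    (hp₄ : (quatMatrix p₄)ᴴ = -quatMatrix p₄) (hp₄0 : (quatMatrix p₄).trace = 0)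
    (hY : ∀ w : (Fin (2 * L - 1 + 1) × Edge 3 L) ⊕ Site 3 L, (Sum.elim (fun ie => quatMatrix (p ie.2.2)) (fun _ => quatMatrix p₄) w)ᴴ =
      -Sum.elim (fun ie => quatMatrix (p ie.2.2)) (fun _ => quatMatrix p₄) w)
    (hY0 : ∀ w : (Fin (2 * L - 1 + 1) × Edge 3 L) ⊕ Site 3 L, (Sum.elim (fun ie => quatMatrix (p ie.2.2)) (fun _ => quatMatrix p₄) w).trace = 0)
    (s : ℝ) :
    ((fun _ : Fin (2 * L - 1 + 1) => (fun e : Edge 3 L => u e.2), fun _ : Site 3 L => q) :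
        (Fin (2 * L - 1 + 1) → GaugeConfig 3 L SU2) × (Site 3 L → SU2)) *
      multiCurve (Sum.elim (fun ie => quatMatrix (p ie.2.2)) (fun _ => quatMatrix p₄)) hY hY0 s =
    ((fun _ : Fin (2 * L - 1 + 1) => (fun e : Edge 3 L => u e.2 * expSU (N := 2) (hp e.2) (hp0 e.2) s),
      fun _ : Site 3 L => q * expSU (N := 2) hp₄ hp₄0 s) : (Fin (2 * L - 1 + 1) → GaugeConfig 3 L SU2) × (Site 3 L → SU2)) := by
  unfold multiCurve
  rfl

/-! ## §2 The deficit of a constant history along the radial flow, and its derivative at `0` -/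

/-- ★★★ **The zero-mode radial flow reproduces the commutator quartic on the constant-history cone.**  With radial generators
`p_k = c_k·Im(su2Quat u_k)`, `p₄ = c₄·Im(su2Quat q)`:
`d/ds|₀ F₀(const(u,q)·γ(s)) = 2L⁴·Σ_{k<k′} 2(c_k Re A_k + c_{k′} Re A_{k′})‖A_kA_{k′} − A_{k′}A_k‖² + L³·Σ_k 2(c_k Re A_k + c₄ Re B)‖A_kB − BA_k‖²`
(`‖·‖² = normSq`). [cite: CosteEtAl1985] -/
theorem hasDerivAt_ringDeficit_const_radial (u : Fin 3 → SU2) (q : SU2) (c : Fin 3 → ℝ) (c₄ : ℝ)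
    (hp : ∀ k, (quatMatrix (c k • (su2Quat (u k)).im))ᴴ = -quatMatrix (c k • (su2Quat (u k)).im))
    (hp0 : ∀ k, (quatMatrix (c k • (su2Quat (u k)).im)).trace = 0)
    (hp₄ : (quatMatrix (c₄ • (su2Quat q).im))ᴴ = -quatMatrix (c₄ • (su2Quat q).im)) (hp₄0 : (quatMatrix (c₄ • (su2Quat q).im)).trace = 0)
    (hY : ∀ w : (Fin (2 * L - 1 + 1) × Edge 3 L) ⊕ Site 3 L,
      (Sum.elim (fun ie => quatMatrix (c ie.2.2 • (su2Quat (u ie.2.2)).im)) (fun _ => quatMatrix (c₄ • (su2Quat q).im)) w)ᴴ =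
        -Sum.elim (fun ie => quatMatrix (c ie.2.2 • (su2Quat (u ie.2.2)).im)) (fun _ => quatMatrix (c₄ • (su2Quat q).im)) w)
    (hY0 : ∀ w : (Fin (2 * L - 1 + 1) × Edge 3 L) ⊕ Site 3 L,
      (Sum.elim (fun ie => quatMatrix (c ie.2.2 • (su2Quat (u ie.2.2)).im)) (fun _ => quatMatrix (c₄ • (su2Quat q).im)) w).trace = 0) :
    HasDerivAt (fun s : ℝ => ringDeficit L (fun _ => false)
        ((((fun _ : Fin (2 * L - 1 + 1) => (fun e : Edge 3 L => u e.2), fun _ : Site 3 L => q) :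
            (Fin (2 * L - 1 + 1) → GaugeConfig 3 L SU2) × (Site 3 L → SU2)) *
          multiCurve (Sum.elim (fun ie => quatMatrix (c ie.2.2 • (su2Quat (u ie.2.2)).im)) (fun _ => quatMatrix (c₄ • (su2Quat q).im))) hY hY0 s)))
      (2 * (L : ℝ) ^ 4 * ∑ pr : {pr : Fin 3 × Fin 3 // pr.1 < pr.2},
          2 * (c pr.1.1 * (su2Quat (u pr.1.1)).re + c pr.1.2 * (su2Quat (u pr.1.2)).re) *
            Quaternion.normSq (su2Quat (u pr.1.1) * su2Quat (u pr.1.2) - su2Quat (u pr.1.2) * su2Quat (u pr.1.1)) +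
        (L : ℝ) ^ 3 * ∑ k : Fin 3, 2 * (c k * (su2Quat (u k)).re + c₄ * (su2Quat q).re) *
            Quaternion.normSq (su2Quat (u k) * su2Quat q - su2Quat q * su2Quat (u k))) 0 := by
  -- the moving quaternions and their radial derivatives at `s = 0`
  set A : Fin 3 → ℝ → ℍ := fun k s => su2Quat (u k * expSU (N := 2) (hp k) (hp0 k) s) with hA
  set B : ℝ → ℍ := fun s => su2Quat (q * expSU (N := 2) hp₄ hp₄0 s) with hB
  have hA0 : ∀ k, A k 0 = su2Quat (u k) := fun k => by simp only [hA, FrameDerivative.expSU_zero, mul_one]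
  have hB0 : B 0 = su2Quat q := by simp only [hB, FrameDerivative.expSU_zero, mul_one]
  have hAd : ∀ k, HasDerivAt (A k) (c k • (A k 0 * (A k 0).im)) 0 := fun k => by
    have h := hasDerivAt_su2Quat_mul_expSU (u k) (c k • (su2Quat (u k)).im) (hp k) (hp0 k) 0
    rw [hA0]
    refine h.congr_deriv ?_
    rw [FrameDerivative.expSU_zero, mul_one, mul_smul_comm]
  have hBd : HasDerivAt B (c₄ • (B 0 * (B 0).im)) 0 := by
    have h := hasDerivAt_su2Quat_mul_expSU q (c₄ • (su2Quat q).im) hp₄ hp₄0 0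
    rw [hB0]
    refine h.congr_deriv ?_
    rw [FrameDerivative.expSU_zero, mul_one, mul_smul_comm]
  -- the deficit along the curve is the commutator quartic of the moving quaternions
  have heq : (fun s : ℝ => ringDeficit L (fun _ => false)
        ((((fun _ : Fin (2 * L - 1 + 1) => (fun e : Edge 3 L => u e.2), fun _ : Site 3 L => q) :
            (Fin (2 * L - 1 + 1) → GaugeConfig 3 L SU2) × (Site 3 L → SU2)) *
          multiCurve (Sum.elim (fun ie => quatMatrix (c ie.2.2 • (su2Quat (u ie.2.2)).im)) (fun _ => quatMatrix (c₄ • (su2Quat q).im)))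
            hY hY0 s))) =
      fun s => 2 * (L : ℝ) ^ 4 * ∑ pr : {pr : Fin 3 × Fin 3 // pr.1 < pr.2},
          Quaternion.normSq (A pr.1.1 s * A pr.1.2 s - A pr.1.2 s * A pr.1.1 s) +
        (L : ℝ) ^ 3 * ∑ k : Fin 3, Quaternion.normSq (A k s * B s - B s * A k s) := by
    funext s
    rw [const_mul_multiCurve u q (fun k => c k • (su2Quat (u k)).im) (c₄ • (su2Quat q).im) hp hp0 hp₄ hp₄0 hY hY0 s]
    have hc := ringDeficit_const_eq_commutator_quartic (L := L) (fun k => u k * expSU (N := 2) (hp k) (hp0 k) s)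
      (q * expSU (N := 2) hp₄ hp₄0 s)
    rw [hc]
    simp only [hA, hB, Quaternion.normSq_eq_norm_mul_self, sq]
  rw [heq]
  -- differentiate term by term
  have hpair : ∀ pr : {pr : Fin 3 × Fin 3 // pr.1 < pr.2},
      HasDerivAt (fun s => Quaternion.normSq (A pr.1.1 s * A pr.1.2 s - A pr.1.2 s * A pr.1.1 s))
        (2 * (c pr.1.1 * (su2Quat (u pr.1.1)).re + c pr.1.2 * (su2Quat (u pr.1.2)).re) *
          Quaternion.normSq (su2Quat (u pr.1.1) * su2Quat (u pr.1.2) - su2Quat (u pr.1.2) * su2Quat (u pr.1.1))) 0 := fun pr => by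
    have h := hasDerivAt_normSq_comm_radial (hAd pr.1.1) (hAd pr.1.2)
    simpa only [hA0] using h
  have hseam : ∀ k : Fin 3, HasDerivAt (fun s => Quaternion.normSq (A k s * B s - B s * A k s))
      (2 * (c k * (su2Quat (u k)).re + c₄ * (su2Quat q).re) * Quaternion.normSq (su2Quat (u k) * su2Quat q - su2Quat q * su2Quat (u k))) 0 :=
    fun k => by
    have h := hasDerivAt_normSq_comm_radial (hAd k) hBd
    simpa only [hA0, hB0] using h
  exact ((HasDerivAt.fun_sum fun pr _ => hpair pr).const_mul _).add ((HasDerivAt.fun_sum fun k _ => hseam k).const_mul _)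

/-- ★★ **The frame form**: the number of `hasDerivAt_ringDeficit_const_radial` IS the multi-direction frame derivative
`frameD Y ringPoly (ringCoord const)` of ✓`FrameHessian` (uniqueness of derivatives). [cite: arXiv220412737, §2 (2.4) (p. 10)] -/
theorem frameD_ringPoly_const_radial (u : Fin 3 → SU2) (q : SU2) (c : Fin 3 → ℝ) (c₄ : ℝ)
    (hp : ∀ k, (quatMatrix (c k • (su2Quat (u k)).im))ᴴ = -quatMatrix (c k • (su2Quat (u k)).im))
    (hp0 : ∀ k, (quatMatrix (c k • (su2Quat (u k)).im)).trace = 0)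
    (hp₄ : (quatMatrix (c₄ • (su2Quat q).im))ᴴ = -quatMatrix (c₄ • (su2Quat q).im)) (hp₄0 : (quatMatrix (c₄ • (su2Quat q).im)).trace = 0)
    (hY : ∀ w : (Fin (2 * L - 1 + 1) × Edge 3 L) ⊕ Site 3 L,
      (Sum.elim (fun ie => quatMatrix (c ie.2.2 • (su2Quat (u ie.2.2)).im)) (fun _ => quatMatrix (c₄ • (su2Quat q).im)) w)ᴴ =
        -Sum.elim (fun ie => quatMatrix (c ie.2.2 • (su2Quat (u ie.2.2)).im)) (fun _ => quatMatrix (c₄ • (su2Quat q).im)) w)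
    (hY0 : ∀ w : (Fin (2 * L - 1 + 1) × Edge 3 L) ⊕ Site 3 L,
      (Sum.elim (fun ie => quatMatrix (c ie.2.2 • (su2Quat (u ie.2.2)).im)) (fun _ => quatMatrix (c₄ • (su2Quat q).im)) w).trace = 0) :
    frameD (Sum.elim (fun ie => quatMatrix (c ie.2.2 • (su2Quat (u ie.2.2)).im)) (fun _ => quatMatrix (c₄ • (su2Quat q).im))) (ringPoly L)
        (ringCoord L (((fun _ : Fin (2 * L - 1 + 1) => (fun e : Edge 3 L => u e.2), fun _ : Site 3 L => q) :
          (Fin (2 * L - 1 + 1) → GaugeConfig 3 L SU2) × (Site 3 L → SU2)))) =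
      2 * (L : ℝ) ^ 4 * ∑ pr : {pr : Fin 3 × Fin 3 // pr.1 < pr.2},
          2 * (c pr.1.1 * (su2Quat (u pr.1.1)).re + c pr.1.2 * (su2Quat (u pr.1.2)).re) *
            Quaternion.normSq (su2Quat (u pr.1.1) * su2Quat (u pr.1.2) - su2Quat (u pr.1.2) * su2Quat (u pr.1.1)) +
        (L : ℝ) ^ 3 * ∑ k : Fin 3, 2 * (c k * (su2Quat (u k)).re + c₄ * (su2Quat q).re) *
            Quaternion.normSq (su2Quat (u k) * su2Quat q - su2Quat q * su2Quat (u k)) := by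
  have h1 := hasDerivAt_ringDeficit_multiCurve
    (Sum.elim (fun ie => quatMatrix (c ie.2.2 • (su2Quat (u ie.2.2)).im)) (fun _ => quatMatrix (c₄ • (su2Quat q).im))) hY hY0
    (((fun _ : Fin (2 * L - 1 + 1) => (fun e : Edge 3 L => u e.2), fun _ : Site 3 L => q) :
      (Fin (2 * L - 1 + 1) → GaugeConfig 3 L SU2) × (Site 3 L → SU2))) 0
  rw [multiCurve_zero, mul_one] at h1
  exact h1.unique (hasDerivAt_ringDeficit_const_radial u q c c₄ hp hp0 hp₄ hp₄0 hY hY0)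

end Summit.QuantumFields.YangMills.Theorems.VirialFluxGap.FrameDerivative

end
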